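import Summits.QuantumFields.YangMills.Theorems.EquipartitionCriticalityLatticeGapLargeBetaHearts

/-!
# Crux stmt-QuantumFields-8761 `LatticeGapLargeBeta` as a continuity method along the Wilson axis
# (strategist's typed decomposition: seed ∧ openness-to-the-right ∧ no-left-endpoint ⇒ crux, BY NAME)

Support file for crux stmt-QuantumFields-8761
(`Summit.QuantumFields.YangMills.Theses.EquipartitionCriticality.LatticeGapLargeBeta`).  The dead line
`Sketch` (card `af-staircase-transport`) transported clustering along `β` by rungs with `β`-UNIFORM losses
`(Δβ, θ, c)`; its macro rungs at `S ≫ ξ(β)` are the weak-coupling gap problem itself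
(`Cruxes/LatticeGapLargeBeta/Lines/Sketch-dead.md`).  This file records the NON-uniform version of the same
idea as pure order topology of the coupling half-line, so that the two places where uniformity in `β` was
secretly needed become two separate, named hypotheses (written out in full as closed propositions, so that
each is a fileable statement signature; no definition is introduced):

* "SC-massive at `β`" (the recurring clause) — some rate `m ∈ (0,1]`, prefactor `K ≥ 2` and volume floor
  `S₀` give the sup-norm × width bound SC(β, S, m, K) of the landed hearts on every torus `(2S+1)⁴`, `S ≥ S₀`
  (the `β`-uniform pair constant of the crux is then free by rate dilution,
  `AfStaircase.latticeGapLargeBeta_of_uniformSlabClustering`, p114825).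
* SEED (hypothesis `hS`) — the massive phase is met at arbitrarily weak coupling: for every bound some
  `β ≥` the bound is SC-massive (an UNBOUNDED SET of massive couplings, not a half-line).
* OPEN-RIGHT (hypothesis `hO`) — beyond a threshold, SC-massiveness is open to the right in `β` with a
  modulus `δ(G, r, β) > 0` that may depend on everything: `[β, β + δ]` stays SC-massive.
* CLOSED-LEFT (hypothesis `hC`) — beyond a threshold, a coupling approached from the left by a whole
  INTERVAL `[β₀, β)` of SC-massive couplings is SC-massive: a massive interval has no critical right
  endpoint (the lattice-unit mass may tend to `0` only at `β = ∞`).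

`latticeGapLargeBeta_of_continuity : SEED → OPEN-RIGHT → CLOSED-LEFT → LatticeGapLargeBeta` is the
least-upper-bound argument on `ℝ` (`Ici_subset_of_mem_of_openRight_of_closedLeft`, generic over a predicate)
followed by the landed heart.  Nothing here is an engine: SEED carries the non-perturbative kernel at each of
infinitely many couplings, CLOSED-LEFT carries it as "no collapse of the gap at a finite coupling", and only
OPEN-RIGHT (stability of volume-uniform strong mixing under a small bounded change of the local interaction) is
of known type and group-blind.  The three together are EQUIVALENT to the SC form of the crux
(the converse — a half-line of SC-massive couplings gives back all three — is trivial), so the split loses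
nothing and none of the three is the crux restated.  See `Cruxes/LatticeGapLargeBeta/STRATEGY-CENSUS.md` §Decomposition.

No definition and no named fact; the only non-logical input is `latticeGapLargeBeta_of_uniformSlabClustering`.
-/

noncomputable section

open scoped BigOperators Topology
open MeasureTheory ProbabilityTheory Filter Set
open Literature.MathematicalPhysics.QuantumFieldTheory Literature.MathematicalPhysics.QuantumLattice

namespace Summit.QuantumFields.YangMills.Theorems.LatticeGapLargeBeta.ContinuitySplit

/-! ### The continuity argument on a half-line (pure order topology of `ℝ`, generic predicate) -/

/-- **Continuity method on `[β₀, ∞)`.**  A set `M ⊆ ℝ` that contains `β₀`, is open to the right at each of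
its points `≥ β₀` (point-dependent modulus), and contains the right endpoint of every interval `[a, β) ⊆ M`
with `a ≥ β₀`, contains the whole half-line `[β₀, ∞)`: the supremum `c` of `{x ≥ β₀ | [β₀, x] ⊆ M}` lies in
`M` by the endpoint property and is then exceeded by openness. [folklore] -/
theorem Ici_subset_of_mem_of_openRight_of_closedLeft {M : Set ℝ} {β₀ : ℝ} (h0 : β₀ ∈ M)
    (hopen : ∀ β : ℝ, β₀ ≤ β → β ∈ M → ∃ δ : ℝ, 0 < δ ∧ ∀ β' : ℝ, β ≤ β' → β' ≤ β + δ → β' ∈ M)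
    (hclosed : ∀ a β : ℝ, β₀ ≤ a → a < β → (∀ x : ℝ, a ≤ x → x < β → x ∈ M) → β ∈ M) :
    ∀ β : ℝ, β₀ ≤ β → β ∈ M := by
  by_contra hcon
  push Not at hcon
  obtain ⟨βs, hβs0, hβsM⟩ := hcon
  -- `T` = the couplings `x ≥ β₀` with `[β₀, x] ⊆ M`.
  set T : Set ℝ := {x | β₀ ≤ x ∧ ∀ y : ℝ, β₀ ≤ y → y ≤ x → y ∈ M} with hT
  have hT0 : β₀ ∈ T := ⟨le_rfl, fun y hy1 hy2 => by
    have : y = β₀ := le_antisymm hy2 hy1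
    rw [this]; exact h0⟩
  have hTne : T.Nonempty := ⟨β₀, hT0⟩
  -- `T` is bounded above by the bad coupling `βs`.
  have hTbdd : ∀ x ∈ T, x ≤ βs := by
    intro x hx
    by_contra hlt
    push Not at hlt
    exact hβsM (hx.2 βs hβs0 hlt.le)
  have hBdd : BddAbove T := ⟨βs, hTbdd⟩
  set c := sSup T with hc
  have hβ0c : β₀ ≤ c := le_csSup hBdd hT0
  -- every `y ∈ [β₀, c)` lies in `M`
  have hbelow : ∀ y : ℝ, β₀ ≤ y → y < c → y ∈ M := by
    intro y hy1 hy2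
    obtain ⟨x, hxT, hyx⟩ := exists_lt_of_lt_csSup hTne hy2
    exact hxT.2 y hy1 hyx.le
  -- hence `c ∈ M`
  have hcM : c ∈ M := by
    rcases eq_or_lt_of_le hβ0c with h | h
    · rw [← h]; exact h0
    · exact hclosed β₀ c le_rfl h hbelow
  -- hence `[β₀, c] ⊆ M`, i.e. `c ∈ T`
  have hcT : c ∈ T := ⟨hβ0c, fun y hy1 hy2 => by
    rcases eq_or_lt_of_le hy2 with h | h
    · rw [h]; exact hcM
    · exact hbelow y hy1 h⟩
  -- openness at `c` pushes past the supremum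
  obtain ⟨δ, hδ, hδM⟩ := hopen c hβ0c hcM
  have hcδT : c + δ ∈ T := by
    refine ⟨hβ0c.trans (by linarith), fun y hy1 hy2 => ?_⟩
    rcases le_or_gt y c with h | h
    · exact hcT.2 y hy1 h
    · exact hδM y h.le hy2
  have : c + δ ≤ c := le_csSup hBdd hcδT
  linarith

/-- **Seed + openness-to-the-right + no-left-endpoint give a whole half-line**, for an arbitrary predicate
`P` on the couplings (think `P β` = "SC-massive at `β`" for one `(G, r)`).  The thresholds of the two local
hypotheses are absorbed by taking the seed beyond both. [folklore] -/
theorem halfLine_of_pieces {P : ℝ → Prop}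
    (hseed : ∀ bnd : ℝ, ∃ β : ℝ, bnd ≤ β ∧ P β)
    (hopen : ∃ β₁ : ℝ, ∀ β : ℝ, β₁ ≤ β → P β →
      ∃ δ : ℝ, 0 < δ ∧ ∀ β' : ℝ, β ≤ β' → β' ≤ β + δ → P β')
    (hclosed : ∃ β₁ : ℝ, ∀ β₀ β : ℝ, β₁ ≤ β₀ → β₀ < β →
      (∀ x : ℝ, β₀ ≤ x → x < β → P x) → P β) :
    ∃ β₀ : ℝ, ∀ β : ℝ, β₀ ≤ β → P β := by
  obtain ⟨β₁, hop⟩ := hopen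
  obtain ⟨β₂, hcl⟩ := hclosed
  obtain ⟨β₀, hβ₀, hM⟩ := hseed (max β₁ β₂)
  have h1 : β₁ ≤ β₀ := (le_max_left _ _).trans hβ₀
  have h2 : β₂ ≤ β₀ := (le_max_right _ _).trans hβ₀
  refine ⟨β₀, Ici_subset_of_mem_of_openRight_of_closedLeft (M := {x | P x}) hM ?_ ?_⟩
  · intro β hβ hβM
    exact hop β (h1.trans hβ) hβM
  · intro a β ha hab hint
    exact hcl a β (h2.trans ha) hab hint

/-! ### The decomposition, with the crux as conclusion BY NAME -/

/-- **The continuity decomposition of the crux, BY NAME** — `SEED → OPEN-RIGHT → CLOSED-LEFT →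
LatticeGapLargeBeta`, each hypothesis a closed proposition in the SC currency (see the module docstring for
the reading).  For each compact simple `G` and faithful `r`, `halfLine_of_pieces` (with `P β` := SC-massive at
`β`) gives a threshold beyond which every coupling is SC-massive, which is exactly the hypothesis of the landed
heart `AfStaircase.latticeGapLargeBeta_of_uniformSlabClustering`; rate dilution there supplies the `β`-uniform
pair constant `C(A,B) = 2e^{2w+1}ab`.  The conjunction of the three hypotheses is (trivially) equivalent to the
SC form of the crux, and none of them alone is the crux restated. -/
theorem latticeGapLargeBeta_of_continuity
    (hS : (∀ (G : Type) [Group G] [TopologicalSpace G] [IsTopologicalGroup G] [CompactSpace G]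
      [MeasurableSpace G] [BorelSpace G], IsCompactSimpleLieGroup G → ∀ (r : LatticeRep G),
      ∀ bnd : ℝ, ∃ β : ℝ, bnd ≤ β ∧
      (∃ (m K : ℝ) (S₀ : ℕ), 0 < m ∧ m ≤ 1 ∧ 2 ≤ K ∧
        ∀ S : ℕ, S₀ ≤ S →
        ∀ (A B : YMSpecies G) (a b : ℝ) (w : ℕ), (∀ U, |A.F U| ≤ a) → (∀ U, |B.F U| ≤ b) →
          (∀ e ∈ A.supp, |e.1 0| ≤ (w : ℤ)) → (∀ e ∈ B.supp, |e.1 0| ≤ (w : ℤ)) →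
          ∀ n : ℕ, n ≤ S →
            |latticeConnectedCorr r.ρ β (2 * S + 1) A.F B.F n| ≤
              K * a * b * Real.exp (m * (2 * w)) * Real.exp (-(m * n)))))
    (hO : (∀ (G : Type) [Group G] [TopologicalSpace G] [IsTopologicalGroup G] [CompactSpace G]
      [MeasurableSpace G] [BorelSpace G], IsCompactSimpleLieGroup G → ∀ (r : LatticeRep G),
      ∃ β₁ : ℝ, ∀ β : ℝ, β₁ ≤ β →
      (∃ (m K : ℝ) (S₀ : ℕ), 0 < m ∧ m ≤ 1 ∧ 2 ≤ K ∧
        ∀ S : ℕ, S₀ ≤ S →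
        ∀ (A B : YMSpecies G) (a b : ℝ) (w : ℕ), (∀ U, |A.F U| ≤ a) → (∀ U, |B.F U| ≤ b) →
          (∀ e ∈ A.supp, |e.1 0| ≤ (w : ℤ)) → (∀ e ∈ B.supp, |e.1 0| ≤ (w : ℤ)) →
          ∀ n : ℕ, n ≤ S →
            |latticeConnectedCorr r.ρ β (2 * S + 1) A.F B.F n| ≤
              K * a * b * Real.exp (m * (2 * w)) * Real.exp (-(m * n))) →
      ∃ δ : ℝ, 0 < δ ∧ ∀ β' : ℝ, β ≤ β' → β' ≤ β + δ →
      (∃ (m K : ℝ) (S₀ : ℕ), 0 < m ∧ m ≤ 1 ∧ 2 ≤ K ∧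
        ∀ S : ℕ, S₀ ≤ S →
        ∀ (A B : YMSpecies G) (a b : ℝ) (w : ℕ), (∀ U, |A.F U| ≤ a) → (∀ U, |B.F U| ≤ b) →
          (∀ e ∈ A.supp, |e.1 0| ≤ (w : ℤ)) → (∀ e ∈ B.supp, |e.1 0| ≤ (w : ℤ)) →
          ∀ n : ℕ, n ≤ S →
            |latticeConnectedCorr r.ρ β' (2 * S + 1) A.F B.F n| ≤
              K * a * b * Real.exp (m * (2 * w)) * Real.exp (-(m * n)))))
    (hC : (∀ (G : Type) [Group G] [TopologicalSpace G] [IsTopologicalGroup G] [CompactSpace G]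
      [MeasurableSpace G] [BorelSpace G], IsCompactSimpleLieGroup G → ∀ (r : LatticeRep G),
      ∃ β₁ : ℝ, ∀ β₀ β : ℝ, β₁ ≤ β₀ → β₀ < β →
      (∀ x : ℝ, β₀ ≤ x → x < β →
      (∃ (m K : ℝ) (S₀ : ℕ), 0 < m ∧ m ≤ 1 ∧ 2 ≤ K ∧
        ∀ S : ℕ, S₀ ≤ S →
        ∀ (A B : YMSpecies G) (a b : ℝ) (w : ℕ), (∀ U, |A.F U| ≤ a) → (∀ U, |B.F U| ≤ b) →
          (∀ e ∈ A.supp, |e.1 0| ≤ (w : ℤ)) → (∀ e ∈ B.supp, |e.1 0| ≤ (w : ℤ)) →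
          ∀ n : ℕ, n ≤ S →
            |latticeConnectedCorr r.ρ x (2 * S + 1) A.F B.F n| ≤
              K * a * b * Real.exp (m * (2 * w)) * Real.exp (-(m * n)))) →
      (∃ (m K : ℝ) (S₀ : ℕ), 0 < m ∧ m ≤ 1 ∧ 2 ≤ K ∧
        ∀ S : ℕ, S₀ ≤ S →
        ∀ (A B : YMSpecies G) (a b : ℝ) (w : ℕ), (∀ U, |A.F U| ≤ a) → (∀ U, |B.F U| ≤ b) →
          (∀ e ∈ A.supp, |e.1 0| ≤ (w : ℤ)) → (∀ e ∈ B.supp, |e.1 0| ≤ (w : ℤ)) →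
          ∀ n : ℕ, n ≤ S →
            |latticeConnectedCorr r.ρ β (2 * S + 1) A.F B.F n| ≤
              K * a * b * Real.exp (m * (2 * w)) * Real.exp (-(m * n))))) :
    Summit.QuantumFields.YangMills.Theses.EquipartitionCriticality.LatticeGapLargeBeta := by
  refine AfStaircase.latticeGapLargeBeta_of_uniformSlabClustering ?_
  intro G _ _ _ _ _ _ hG r
  exact halfLine_of_pieces (hS G hG r) (hO G hG r) (hC G hG r)

end Summit.QuantumFields.YangMills.Theorems.LatticeGapLargeBeta.ContinuitySplit

end
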